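import Mathlib
import Literature.Analysis.Fourier.FourierCompactSupportAnalytic
import Literature.NumberTheory.LFunctions.SuzukiCanonicalSystem
import Literature.NumberTheory.LFunctions.SuzukiSingleOperatorKernelProofs
import Literature.NumberTheory.LFunctions.RiemannXiProofs
import Literature.Barriers.RiemannHypothesis.AbsoluteZetaPolynomialCounting
import Summits.RiemannHypothesis.RiemannHypothesis.Theorems.DeBrangesSuzukiDoorDefs
import Summits.RiemannHypothesis.RiemannHypothesis.Theorems.SuzukiWindowsDoorConverseFubini
import Summits.RiemannHypothesis.RiemannHypothesis.Theorems.SuzukiWindowsDoorConversePlancherel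
import Summits.RiemannHypothesis.RiemannHypothesis.Theorems.SuzukiWindowsDoorConverseVanishing

/-!
# v6 «SuzukiWindowsDoorConverse» — L7: RH ⇒ every window of `K_θ` is free of the eigenvalues ±1

RH-EQUIVALENCE bookkeeping (the converse half of [Su20, arXiv:1907.07302, p.2]'s printed wish "RH ⟺ (K1)–(K5) for a
single operator"), as an RH-FREE IMPLICATION: if `ξ` has no zero with `Re s > 1/2` then, for every `θ > 10` and
every `t`, `±1` is not an eigenvalue of `f ↦ ∫_{(−t,t)} K_θ(·+y) f(y) dy` on `L²(−t,t)`.  Mechanism (ζ enters only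
through three inputs, all hypotheses here and discharged by the cell's v5 modules): `|Θ_θ| ≤ 1` on `ℂ₊` (inner
symbol), the kernel growth `|K_θ| ≤ D_δ e^{4δx}`, holomorphy of `Θ_θ` on `ℂ₊`; then L4 (Fubini), L5 (Plancherel
contraction on `Im z = c`), L6 (`c → 0⁺`: an eigenfunction's image lives in the window), the entire window
transforms, and the symbol-rigidity door (`xi_ne_zero_of_symbolQuotientOn`, η = −1) which would make `ξ` zero-free on
`Re s > −1/2` — contradicting the certified zero `ρ₁ = 1/2 + i·14.13…` (tree).  Nothing here bears on the truth of RH.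
-/

set_option linter.dupNamespace false

open MeasureTheory Set Filter Complex Topology FourierTransform

namespace Summit.RiemannHypothesis.RiemannHypothesis.Theorems.SuzukiWindowsDoorConverse

/-! ### A. The symbol-quotient identity forced by an eigenfunction (abstract kernel; RH-FREE, ζ-FREE) -/

/-- RH-FREE (abstract kernel): an eigenfunction `f` (eigenvalue `ε = ±1`) of the windowed Hankel operator forces
`Θ(z) · F♭(z) = ε · F(z)` on `ℂ₊`, where `F(z) = ∫_s f e^{izy}`, `F♭(z) = ∫_s f e^{−izy}`. -/
theorem symbolQuotient_of_eigen {K : ℝ → ℝ} (hKc : Continuous K) (hK0 : ∀ x : ℝ, x < 0 → K x = 0)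
    {Θ : ℂ → ℂ} (hΘ : ∀ z : ℂ, 0 < z.im → ‖Θ z‖ ≤ 1)
    (hLap : ∀ z : ℂ, 0 < z.im →
      Integrable (fun x : ℝ => (K x : ℂ) * Complex.exp (I * z * (x : ℂ))) ∧
        ∫ x : ℝ, (K x : ℂ) * Complex.exp (I * z * (x : ℂ)) = Θ z)
    (hGrowth : ∀ δ : ℝ, 0 < δ → δ ≤ 1 / 16 → ∃ D : ℝ, ∀ x : ℝ, |K x| ≤ D * Real.exp (4 * δ * x))
    {t ε : ℝ} (hε : ε = 1 ∨ ε = -1) {f : ℝ → ℝ} (hf : MemLp f 2 (volume.restrict (Ioo (-t) t)))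
    (heig : ∀ᵐ x ∂(volume.restrict (Ioo (-t) t)), (∫ y in Ioo (-t) t, K (x + y) * f y) = ε * f x) :
    ∀ z : ℂ, 0 < z.im →
      Θ z * (∫ y in Ioo (-t) t, (f y : ℂ) * Complex.exp (-(I * z * (y : ℂ)))) =
        (ε : ℂ) * ∫ y in Ioo (-t) t, (f y : ℂ) * Complex.exp (I * z * (y : ℂ)) := by
  intro z hz
  set s : Set ℝ := Ioo (-t) t with hs_def
  have hs : MeasurableSet s := measurableSet_Ioo
  set g : ℝ → ℝ := fun x => ∫ y in s, K (x + y) * f y with hg_def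
  have hgc : Continuous g := continuous_opWindow hKc hf
  -- L4
  have hFub := laplace_opWindow_eq hKc hz (hLap z hz).1 (hLap z hz).2 hf
  -- L5 for every c, then L6
  have hL5 : ∀ c : ℝ, 0 < c → c ≤ 1 / 2 →
      Integrable (fun x : ℝ => g x ^ 2 * Real.exp (-(2 * c) * x)) ∧
        ∫ x : ℝ, g x ^ 2 * Real.exp (-(2 * c) * x) ≤ ∫ y in s, f y ^ 2 * Real.exp (2 * c * y) :=
    fun c hc hc1 => weighted_contraction hKc hK0 hΘ hGrowth
      (fun w hw t' f' hf' => laplace_opWindow_eq hKc hw (hLap w hw).1 (hLap w hw).2 hf')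
      (fun t' f' hf' => continuous_opWindow hKc hf') hf hc hc1
  have hg1 : ∀ x : ℝ, t < x → g x = 0 := eq_zero_beyond_window hgc hε hf heig hL5
  have hg0 : ∀ x : ℝ, x < -t → g x = 0 := by
    intro x hx
    refine setIntegral_eq_zero_of_forall_eq_zero fun y hy => ?_
    rw [hK0 (x + y) (by have := hy.2; linarith), zero_mul]
  have hae : g =ᵐ[volume] s.indicator fun y => ε * f y := ae_eq_indicator_of_eigen hg0 hg1 heig
  -- ∫ g e^{izx} = ε F(z)
  have hG : ∫ x : ℝ, ((g x : ℝ) : ℂ) * Complex.exp (I * z * (x : ℂ)) =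
      (ε : ℂ) * ∫ y in s, (f y : ℂ) * Complex.exp (I * z * (y : ℂ)) := by
    have h1 : (fun x : ℝ => ((g x : ℝ) : ℂ) * Complex.exp (I * z * (x : ℂ))) =ᵐ[volume]
        s.indicator fun y => (ε : ℂ) * ((f y : ℂ) * Complex.exp (I * z * (y : ℂ))) := by
      filter_upwards [hae] with x hx
      rw [hx]
      by_cases hxs : x ∈ s
      · simp only [indicator_of_mem hxs]; push_cast; ring
      · simp only [indicator_of_notMem hxs]; simp
    rw [integral_congr_ae h1, integral_indicator hs, integral_const_mul]
  rw [← hFub.2, hG]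

/-! ### B. The window transforms are entire; `F♭ ≢ 0` unless `f = 0` a.e. (RH-FREE, ζ-FREE) -/

/-- The windowed function `1_{(−t,t)} f` as a complex `L¹` function vanishing off `[−|t|, |t|]`. -/
theorem window_indicator_integrable {t : ℝ} {f : ℝ → ℝ} (hf : MemLp f 2 (volume.restrict (Ioo (-t) t))) :
    Integrable ((Ioo (-t) t).indicator fun y => (f y : ℂ)) ∧
      ∀ x : ℝ, x ∉ Icc (-|t|) |t| → ((Ioo (-t) t).indicator fun y => (f y : ℂ)) x = 0 := by
  have hs : MeasurableSet (Ioo (-t) t) := measurableSet_Ioo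
  haveI : IsFiniteMeasure (volume.restrict (Ioo (-t) t)) := by infer_instance
  refine ⟨?_, fun x hx => ?_⟩
  · rw [integrable_indicator_iff hs]
    exact (hf.integrable one_le_two).ofReal
  · apply indicator_of_notMem
    intro hxs
    apply hx
    have := le_abs_self t
    exact ⟨by linarith [hxs.1], by linarith [hxs.2]⟩

/-- The two window transforms in terms of the tree's Fourier–Laplace integral. -/
theorem windowTransform_eq {t : ℝ} (f : ℝ → ℝ) (z : ℂ) :
    (∫ y in Ioo (-t) t, (f y : ℂ) * Complex.exp (-(I * z * (y : ℂ)))) =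
      ∫ v : ℝ, Complex.exp (((-(2 * Real.pi * v) : ℝ) : ℂ) * (z / (2 * Real.pi)) * Complex.I) *
        ((Ioo (-t) t).indicator fun y => (f y : ℂ)) v := by
  have hs : MeasurableSet (Ioo (-t) t) := measurableSet_Ioo
  have : (fun v : ℝ => Complex.exp (((-(2 * Real.pi * v) : ℝ) : ℂ) * (z / (2 * Real.pi)) * Complex.I) *
      ((Ioo (-t) t).indicator fun y => (f y : ℂ)) v) =
      (Ioo (-t) t).indicator fun v => (f v : ℂ) * Complex.exp (-(I * z * (v : ℂ))) := by
    funext v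
    by_cases hv : v ∈ Ioo (-t) t
    · simp only [indicator_of_mem hv]
      rw [mul_comm]
      congr 1
      congr 1
      have hπ : (Real.pi : ℂ) ≠ 0 := by exact_mod_cast Real.pi_ne_zero
      push_cast
      field_simp
    · simp only [indicator_of_notMem hv, mul_zero]
  rw [this, integral_indicator hs]

/-- RH-FREE auxiliary (`windowTransform_eq'`). -/
theorem windowTransform_eq' {t : ℝ} (f : ℝ → ℝ) (z : ℂ) :
    (∫ y in Ioo (-t) t, (f y : ℂ) * Complex.exp (I * z * (y : ℂ))) =
      ∫ v : ℝ, Complex.exp (((-(2 * Real.pi * v) : ℝ) : ℂ) * (-z / (2 * Real.pi)) * Complex.I) *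
        ((Ioo (-t) t).indicator fun y => (f y : ℂ)) v := by
  rw [← windowTransform_eq f (-z)]
  refine integral_congr_ae (Eventually.of_forall fun y => ?_)
  simp only
  congr 2
  ring

/-- RH-FREE: both window transforms are entire. -/
theorem differentiable_windowTransform {t : ℝ} {f : ℝ → ℝ}
    (hf : MemLp f 2 (volume.restrict (Ioo (-t) t))) :
    Differentiable ℂ (fun z : ℂ => ∫ y in Ioo (-t) t, (f y : ℂ) * Complex.exp (I * z * (y : ℂ))) ∧
      Differentiable ℂ (fun z : ℂ => ∫ y in Ioo (-t) t, (f y : ℂ) * Complex.exp (-(I * z * (y : ℂ)))) := by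
  obtain ⟨hψ, h0⟩ := window_indicator_integrable hf
  have hE := Literature.Analysis.Fourier.differentiable_fourierLaplace hψ (abs_nonneg t) h0
  constructor
  · have : (fun z : ℂ => ∫ y in Ioo (-t) t, (f y : ℂ) * Complex.exp (I * z * (y : ℂ))) =
        (fun w : ℂ => ∫ v : ℝ, Complex.exp (((-(2 * Real.pi * v) : ℝ) : ℂ) * w * Complex.I) *
          ((Ioo (-t) t).indicator fun y => (f y : ℂ)) v) ∘ fun z : ℂ => -z / (2 * Real.pi) := by
      funext z; exact windowTransform_eq' f z
    rw [this]
    exact hE.comp (by fun_prop)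
  · have : (fun z : ℂ => ∫ y in Ioo (-t) t, (f y : ℂ) * Complex.exp (-(I * z * (y : ℂ)))) =
        (fun w : ℂ => ∫ v : ℝ, Complex.exp (((-(2 * Real.pi * v) : ℝ) : ℂ) * w * Complex.I) *
          ((Ioo (-t) t).indicator fun y => (f y : ℂ)) v) ∘ fun z : ℂ => z / (2 * Real.pi) := by
      funext z; exact windowTransform_eq f z
    rw [this]
    exact hE.comp (by fun_prop)

/-- RH-FREE: if `f ≠ 0` in `L²(−t,t)` then `F♭` does not vanish identically on `Im z > −1` (Fourier uniqueness). -/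
theorem windowTransform_ne_zero {t : ℝ} {f : ℝ → ℝ} (hf : MemLp f 2 (volume.restrict (Ioo (-t) t)))
    (hf0 : ¬ f =ᵐ[volume.restrict (Ioo (-t) t)] 0) :
    ∃ z : ℂ, (-1 : ℝ) < z.im ∧ (∫ y in Ioo (-t) t, (f y : ℂ) * Complex.exp (-(I * z * (y : ℂ)))) ≠ 0 := by
  by_contra hcon
  push Not at hcon
  obtain ⟨hψ, h0⟩ := window_indicator_integrable hf
  have hs : MeasurableSet (Ioo (-t) t) := measurableSet_Ioo
  -- 𝓕 ψ = 0
  have hF0 : ∀ ξ : ℝ, 𝓕 ((Ioo (-t) t).indicator fun y => (f y : ℂ)) ξ = 0 := by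
    intro ξ
    rw [Literature.Analysis.Fourier.fourier_eq_fourierLaplace]
    have h := hcon (2 * Real.pi * ξ) (by simp)
    rw [windowTransform_eq] at h
    have hπ : (Real.pi : ℂ) ≠ 0 := by exact_mod_cast Real.pi_ne_zero
    have : ((2 * Real.pi * ξ : ℂ)) / (2 * Real.pi) = (ξ : ℂ) := by field_simp
    simpa [this] using h
  have hψ0 := Literature.Analysis.Fourier.ae_eq_zero_of_forall_fourier_eq_zero hψ hF0
  apply hf0
  have h1 : ∀ᵐ y ∂(volume.restrict (Ioo (-t) t)), ((Ioo (-t) t).indicator fun y => (f y : ℂ)) y = 0 :=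
    ae_restrict_of_ae hψ0
  filter_upwards [h1, ae_restrict_mem hs] with y hy hys
  rw [indicator_of_mem hys] at hy
  exact_mod_cast hy

/-! ### C. RH-EQUIVALENCE bookkeeping: `ξ` zero-free on `Re s > 1/2` ⇒ no window of `K_θ` has eigenvalue ±1 -/

open Literature.NumberTheory.LFunctions (riemannXi NoUnitEigenvalue limTheta limKernel
  Suzuki2020_thm12_continuous Suzuki2020_thm12_Kiii riemannXi_eq_zero_iff_holds)

/-- **RH-EQUIVALENCE (converse half, as an RH-FREE implication).**  If `ξ ≠ 0` on `Re s > 1/2` then for every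
`θ > 10` and every `t`, `±1` is not an eigenvalue of the windowed operator of `K_θ` on `L²(−t,t)`.  The three inputs in
which `ζ` enters (inner symbol, kernel growth, holomorphy of `Θ_θ` on `ℂ₊`) and the symbol-rigidity door are
hypotheses, discharged by the cell's modules (`InnerSymbol`, v5 `SuzukiWeightedDoorConverse`, v5 `SuzukiWeightedDoorDoor`). -/
theorem noUnitEigenvalue_of_inputs {θ : ℝ} (hθ : 1 < θ)
    (hΘ : ∀ z : ℂ, 0 < z.im → ‖SuzukiDoor.limTheta θ z‖ ≤ 1)
    (hLap : ∀ z : ℂ, 0 < z.im →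
      Integrable (fun x : ℝ => (SuzukiDoor.limKernel θ x : ℂ) * Complex.exp (I * z * (x : ℂ))) ∧
        ∫ x : ℝ, (SuzukiDoor.limKernel θ x : ℂ) * Complex.exp (I * z * (x : ℂ)) = SuzukiDoor.limTheta θ z)
    (hGrowth : ∀ δ : ℝ, 0 < δ → δ ≤ 1 / 16 → ∃ D : ℝ, ∀ x : ℝ,
      |SuzukiDoor.limKernel θ x| ≤ D * Real.exp (4 * δ * x))
    (hRig : ∀ G F : ℂ → ℂ, DifferentiableOn ℂ G {z : ℂ | (-1 : ℝ) < z.im} →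
      DifferentiableOn ℂ F {z : ℂ | (-1 : ℝ) < z.im} → (∃ z : ℂ, (-1 : ℝ) < z.im ∧ F z ≠ 0) →
      (∀ z : ℂ, (1 / 2 : ℝ) < z.im → SuzukiDoor.limTheta θ z * F z = G z) →
      ∀ s : ℂ, 1 / 2 + (-1 : ℝ) < s.re → riemannXi s ≠ 0)
    (t : ℝ) : NoUnitEigenvalue (SuzukiDoor.limKernel θ) t := by
  intro ε hε f hf heig
  by_contra hf0
  have hKc : Continuous (SuzukiDoor.limKernel θ) := Suzuki2020_thm12_continuous hθ
  have hK0 : ∀ x : ℝ, x < 0 → SuzukiDoor.limKernel θ x = 0 := fun x hx => Suzuki2020_thm12_Kiii hθ hx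
  have hQ := symbolQuotient_of_eigen hKc hK0 hΘ hLap hGrowth hε hf heig
  obtain ⟨hFd, hFbd⟩ := differentiable_windowTransform hf
  obtain ⟨z₁, hz₁, hF1⟩ := windowTransform_ne_zero hf hf0
  -- the door with η = −1: ξ ≠ 0 on Re s > −1/2
  have hfree := hRig (fun z => (ε : ℂ) * ∫ y in Ioo (-t) t, (f y : ℂ) * Complex.exp (I * z * (y : ℂ)))
    (fun z => ∫ y in Ioo (-t) t, (f y : ℂ) * Complex.exp (-(I * z * (y : ℂ))))
    ((hFd.const_mul (ε : ℂ)).differentiableOn) hFbd.differentiableOn ⟨z₁, hz₁, hF1⟩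
    (fun z hz => hQ z (by linarith))
  -- … contradicting the certified zero ρ₁ on the critical line
  obtain ⟨ρ, hζ, hre, -, -⟩ := Literature.Barriers.RiemannHypothesis.exists_riemannZeta_zero_criticalLine
  have hξ : riemannXi ρ = 0 := (riemannXi_eq_zero_iff_holds ρ).2 ⟨hζ, by rw [hre]; norm_num, by rw [hre]; norm_num⟩
  exact hfree ρ (by rw [hre]; norm_num) hξ

end Summit.RiemannHypothesis.RiemannHypothesis.Theorems.SuzukiWindowsDoorConverse
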